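import Mathlib
import Literature.MathematicalPhysics.KineticTheory.KickMatchedHardSphereGas
import Literature.MathematicalPhysics.KineticTheory.HardSphereEulerProofs
import Literature.MathematicalPhysics.KineticTheory.KickMatchedMeasurable
import HarnessLib

/-!
# KickMatchedHardSphereGasStatements

Topic `Literature/MathematicalPhysics/KineticTheory`. Named literature fact(s) relocated by the gate from `Summits/AtomisticToContinuum/HydrodynamicLimit/Theorems/InformationPercolationEnginePercolationClosesChaosOneKickInfluenceReduction.lean`
(accept-time relocation of `[cite]`d propositions written inline in a Summits proposal; human ruling 2026-08-15).

* `Literature.MathematicalPhysics.KineticTheory.OneKickInfluence`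
* `Literature.MathematicalPhysics.KineticTheory.SquaredInfluenceBound`
-/

namespace Literature.MathematicalPhysics.KineticTheory

open scoped BigOperators ENNReal Topology RealInnerProductSpace
open MeasureTheory Set Filter
open Literature.Analysis.FluidPDE
open Literature.MathematicalPhysics.KineticTheory
open Literature.MathematicalPhysics.KineticTheory.KickMatchedHardSphereGas

/-- **S2 · `OneKickInfluence` — the Stein factor, in LINDEBERG form: the total one-kick influence carried by
collisions whose influence exceeds `C·ε/(N+1)` is negligible in local-Gibbs mean.** For `σ < σ₀(profiles)`, all
`Φ, τ, χ, Ψ, η, r` and every `ϑ > 0` there are `C ≥ 0` and `N₀` with, for `N ≥ N₀`,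
`E_localGibbs[ Σ_{k < numColl} influence_k · 1{influence_k > C ε/(N+1)} ] ≤ ϑ` — uniform integrability of the
normalised influences under the collision Campbell measure (the analogue of Lindeberg's condition
`Σ E[X_k² ; |X_k| > ε] → 0`). Verbatim the statement of the line skeleton
`Cruxes/PercolationClosesChaos/Lines/stein-lindeberg-kick-swap.lean`. [folklore]
[file MathematicalPhysics/KineticTheory/KickMatchedHardSphereGasStatements] -/
def OneKickInfluence : Prop :=
  ∀ (a₀ θ₀ : T3 → ℝ) (u₀ : T3 → V3), Continuous a₀ → Continuous θ₀ → Continuous u₀ → (∀ x, 0 < a₀ x) →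
    (∀ x, 0 < θ₀ x) → ∃ σ₀ : ℝ, 0 < σ₀ ∧ ∀ σ : ℝ, 0 < σ → σ < σ₀ → ∀ Φ : (N : ℕ) → Flow σ N,
    ∀ τ : ℝ, 0 < τ → ∀ χ : ℝ × T3 → ℝ, Continuous χ → ∀ Ψ : V3 × V3 × V3 → ℝ, Continuous Ψ →
    (∃ C : ℝ, ∀ p, |Ψ p| ≤ C) → ∀ η r ϑ : ℝ, 0 < η → 0 < r → 0 < ϑ → ∃ C : ℝ, 0 ≤ C ∧ ∃ N₀ : ℕ, ∀ N : ℕ, N₀ ≤ N →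
      ∫⁻ z, ENNReal.ofReal (∑ k ∈ Finset.range (numColl σ N (Φ N) τ z),
          if C * (hsDiameter σ N / (N + 1 : ℝ)) < influence σ N (Φ N) τ χ Ψ r η z k
          then influence σ N (Φ N) τ χ Ψ r η z k else 0)
        ∂(localGibbsLaw σ a₀ u₀ θ₀ N (Φ N)) ≤ ENNReal.ofReal ϑ

/-! ## The Lindeberg architecture: Stein-factor domination + Campbell uniform integrability -/

/-- **The squared-influence (Efron–Stein / Chatterjee) currency of S2**: the local-Gibbs mean of `Σ_k influence_k²`
is `≤ K · ε/(N+1)` uniformly in `N ≥ N₀` (each of the `≍ N^{4/3} τ` collisions has influence `O(ε/N)`). [folklore]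
[file MathematicalPhysics/KineticTheory/KickMatchedHardSphereGasStatements] -/
def SquaredInfluenceBound : Prop :=
  ∀ (a₀ θ₀ : T3 → ℝ) (u₀ : T3 → V3), Continuous a₀ → Continuous θ₀ → Continuous u₀ → (∀ x, 0 < a₀ x) →
    (∀ x, 0 < θ₀ x) → ∃ σ₀ : ℝ, 0 < σ₀ ∧ ∀ σ : ℝ, 0 < σ → σ < σ₀ → ∀ Φ : (N : ℕ) → Flow σ N,
    ∀ τ : ℝ, 0 < τ → ∀ χ : ℝ × T3 → ℝ, Continuous χ → ∀ Ψ : V3 × V3 × V3 → ℝ, Continuous Ψ →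
    (∃ C : ℝ, ∀ p, |Ψ p| ≤ C) → ∀ η r : ℝ, 0 < η → 0 < r → ∃ K : ℝ, 0 ≤ K ∧ ∃ N₀ : ℕ, ∀ N : ℕ, N₀ ≤ N →
      ∫⁻ z, ENNReal.ofReal (∑ k ∈ Finset.range (numColl σ N (Φ N) τ z), influence σ N (Φ N) τ χ Ψ r η z k ^ 2)
        ∂(localGibbsLaw σ a₀ u₀ θ₀ N (Φ N)) ≤ ENNReal.ofReal (K * (hsDiameter σ N / (N + 1 : ℝ)))

/-! ### The assembly lemmas (proved) -/

/-! ## The remaining statements of the line `stein-lindeberg-kick-swap` (W, W2, S1, S3, S3a, S3b) and their proved glue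

Appended by the line lead (`prover-line-stmt-AtomisticToContinuum-13914-0`, 2026-08-16) so that the registered stubs of the
skeleton `Summits/AtomisticToContinuum/HydrodynamicLimit/Cruxes/PercolationClosesChaos/Lines/stein-lindeberg-kick-swap.lean` can be
stated from `Theorems/` files over importable names (the gate relocates inline `def … : Prop` of Summits proposals here anyway).
These are TARGETS of a crux line (conjectural statements), tagged `[folklore]` as constructions of statements; nothing here asserts
them. W1 `KickMatchedMeasurable` lives in `Literature.MathematicalPhysics.KineticTheory.KickMatchedMeasurable` (moved
2026-08-16 out of `Literature.Uncategorized`; also proved in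
`Summits/…/Theorems/InformationPercolationEnginePercolationClosesChaosKickMatchedMeasurable.lean`), S2 `OneKickInfluence` above. -/

/-- **W · `Z*` is a well-posed, Gibbs-stationary Markov gas** (the CONSTRUCTION statement for the posited comparison
object; size M–L; TRIAGE-r1-2 App. C / r1-3 §A checked stationarity on paper: resampling the normal from its
conditional (admissible-flux) law given everything else is a heat-bath move on the exit-flux measure, and the specular
step maps exit flux to entry flux — `Z*` is STATIONARY, not reversible). For `σ < σ₀`, every `θe > 0`, `N`, `Φ`:
(i) the time-`t` map `(z, u) ↦ Z*_t` is measurable; (ii) the homogeneous Gibbs law `G_N = localGibbsLaw σ 1 0 θe N Φ`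
is invariant: `(G_N ⊗ kmDice) ∘ (Z*_t)⁻¹ = G_N` for `t ≥ 0`; (iii) `G_N ⊗ kmDice`-a.s. the collision instants do not
accumulate and, at every collision that happens, the incoming pair is unique and the rejection sampler finds an
admissible candidate (so `kmNormal` is a genuine draw from the restricted flux law). [folklore] -/
def KickMatchedStationary : Prop :=
  ∃ σ₀ : ℝ, 0 < σ₀ ∧ ∀ σ : ℝ, 0 < σ → σ < σ₀ → ∀ θe : ℝ, 0 < θe → ∀ (N : ℕ) (Φ : Flow σ N),
    (∀ t : ℝ, Measurable fun q : Cfg N × (ℕ → Die) => kmFlow σ N q.2 q.1 t) ∧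
    (∀ t : ℝ, 0 ≤ t →
      ((localGibbsLaw σ (fun _ => 1) (fun _ => 0) (fun _ => θe) N Φ).prod kmDice).map
          (fun q : Cfg N × (ℕ → Die) => kmFlow σ N q.2 q.1 t) =
        localGibbsLaw σ (fun _ => 1) (fun _ => 0) (fun _ => θe) N Φ) ∧
    (∀ᵐ q ∂((localGibbsLaw σ (fun _ => 1) (fun _ => 0) (fun _ => θe) N Φ).prod kmDice),
      (∀ t : ℝ, ∃ k : ℕ, ENNReal.ofReal t < Driven.instant geo (hsDiameter σ N) (kmRule σ N) q.2 q.1 k) ∧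
      (∀ k : ℕ, Driven.instant geo (hsDiameter σ N) (kmRule σ N) q.2 q.1 (k + 1) ≠ ∞ →
        let y := Driven.stateAfter geo (hsDiameter σ N) (kmRule σ N) q.2 q.1 k
        let y' := freeFlight geo (Alexander.freeExitTime geo (hsDiameter σ N) y).toReal y
        ∃ p ∈ Alexander.incomingPairs geo (hsDiameter σ N) y',
          (∀ p' ∈ Alexander.incomingPairs geo (hsDiameter σ N) y', p' = p) ∧
          ∃ n : ℕ, ‖q.2 k n‖ ≤ 1 ∧
            IsAdmissible σ N p.1 p.2
              (Lambert.lift (‖(y' p.2).2 - (y' p.1).2‖⁻¹ • ((y' p.2).2 - (y' p.1).2)) (q.2 k n)) y'))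

/-- **S1 · `FairGasContactChaos` — averaged molecular chaos at contact FOR THE COMPARISON GAS `Z*`** (size XL, open;
the Transfer's premise). The crux target's statement with the deterministic orbit replaced by the `Z*` path and the
local Gibbs law by `localGibbsLaw ⊗ kmDice`: for `σ < σ₀(profiles)`, every flow family (it only fixes the phase
space of `localGibbsLaw`), `τ, χ, Ψ, η, δ`: `∃ r₀ ∀ r < r₀ ∃ N₀ ∀ N ≥ N₀`,
`(localGibbsLaw ⊗ kmDice){(z,u) | η < |D(Z*(z,u))|} ≤ δ`. WHY EASIER than the crux target: `Z*` is a Markov gas with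
an explicit stationary law, conservative noise at EVERY contact and kicks independent given their inputs — the class
where Kac's programme / OVY–FFL local-equilibrium technology / the route's own percolation census are theorem-shaped
(none of Disproof §§2–3, F3(d) applying to the idealised network there); partner SELECTION of the deterministic gas
is never assumed anywhere in this line, it is transferred from here. Honest caveat (all three triagers): no printed
Euler-scale LE theorem covers contact-only noise at fixed density (OVY93 needs bulk exchange noise of diverging
intensity, FFL94/LO96 are lattice) — open, not a costume. [folklore] -/
def FairGasContactChaos : Prop :=
  ∀ (a₀ θ₀ : T3 → ℝ) (u₀ : T3 → V3), Continuous a₀ → Continuous θ₀ → Continuous u₀ → (∀ x, 0 < a₀ x) →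
    (∀ x, 0 < θ₀ x) → ∃ σ₀ : ℝ, 0 < σ₀ ∧ ∀ σ : ℝ, 0 < σ → σ < σ₀ → ∀ Φ : (N : ℕ) → Flow σ N,
    ∀ τ : ℝ, 0 < τ → ∀ χ : ℝ × T3 → ℝ, Continuous χ → ∀ Ψ : V3 × V3 × V3 → ℝ, Continuous Ψ →
    (∃ C : ℝ, ∀ p, |Ψ p| ≤ C) → ∀ η δ : ℝ, 0 < η → 0 < δ → ∃ r₀ : ℝ, 0 < r₀ ∧ ∀ r : ℝ, 0 < r → r < r₀ →
    ∃ N₀ : ℕ, ∀ N : ℕ, N₀ ≤ N →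
      ((localGibbsLaw σ a₀ u₀ θ₀ N (Φ N)).prod kmDice) {q | η < |starDefect σ N τ χ Ψ r q|} ≤ ENNReal.ofReal δ

/-- **S3 · `KickAmbientDomination` — the chronological Lindeberg swap against `Z*` is dominated by the comparison
gas, by finitely many TYPED `KickIsotropyInfo` functionals with macroscopic weights `h = s_m(v, w)`, and by a
vanishing remainder** (size XL, open — the kick–ambient conspiracy functional of the card IS the remainder `δ`; this
is the line's exposure, Boltzmann-hypothesis class with INSTANTANEOUS fine conditioning, history-free). Content of the
intended proof: (a) smoothing `1{|x| > η} ≤ φ_{η/2} ≤ 1{|x| > η/2}` and the EXACT swap identity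
`E φ(D_true) − E φ(D_{Z*}) = E Σ_{k < numColl} D_k(ω_k)`, `D_k(ω) := 1_adm(ω)[swapValue_k(ω) − restricted admissible-flux
mean]` (`stein_lindeberg_identity` on the contact-indexed chain with clock and running sum adjoined; RESTRICTED
reference, TRIAGE-r1-1 sharpen); (b) a finite dictionary expansion `D_k(ω) = (ε/(N+1))[Σ_{m<m₀} a_{k,m} g_m(ω, v_k, w_k)
+ R_k]` with `g_m` continuous, bounded, flux-mean-zero — `g_m = c(v,w)·(p_m(ω) − p̄_m(v,w))`, polynomial `p_m`, cutoff
`c` vanishing at `v = w` (TRIAGE-r1-3 sharpen) — and coefficients `|a_{k,m}| ≤ C` off the `ϑ`-weight exceptional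
collisions of `OneKickInfluence` (where `|D_k| ≤ 2` since `φ ∈ [0,1]`); (c) the split
`E[a_{k,m} g_m(ω_k)] = E[a_{k,m} ḡ_{k,m}] + E[a_{k,m}(g_m(ω_k) − ḡ_{k,m})]`, `ḡ_{k,m} := E[g_m(ω_k) | v_k, w_k]`, whose first
part is `≤ C · E[(ε/(N+1)) Σ_k s_m(v_k,w_k) g_m(ω_k)]`, `s_m = sign ḡ_{k,m}(·,·)` measurable with `|s_m| ≤ 1` — a
`kickFunctional` with the weight `velWeight s_m` after the ordered-record double count; (d) THE CONSPIRACY: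
`Σ_m Σ_k (ε/(N+1)) E[a_{k,m}(g_m(ω_k) − ḡ_{k,m})] + Σ_k (ε/(N+1)) E[R_k(ω_k)] → 0` AS A WHOLE (never harmonic by harmonic:
card falsifier (d)) — identically `0` under the invariant Gibbs law for this LINEAR-in-`B` bookkeeping (Palm: given the
full pre-collisional rest, `ω_k` is admissible-flux distributed, so `E[D_k(ω_k) | rest] = 0`, and `ḡ ≡ 0` by isotropy),
carried out of equilibrium by instantaneous 3-clusters at scale `Aε` (weight `πσ³`), attacked by the card's Maxwellian
bootstrap, honest floor `O(σ³/A)`. Conditioning on `(v, w)` only: adding the `r`-cell fields `F_r` of the card changes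
(c)+(d) by `≤ C(E|ḡ^{vw}| + E|ḡ^{vwF}|)`, a Kick-small amount. [folklore] -/
def KickAmbientDomination : Prop :=
  ∀ (a₀ θ₀ : T3 → ℝ) (u₀ : T3 → V3), Continuous a₀ → Continuous θ₀ → Continuous u₀ → (∀ x, 0 < a₀ x) →
    (∀ x, 0 < θ₀ x) → ∃ σ₀ : ℝ, 0 < σ₀ ∧ ∀ σ : ℝ, 0 < σ → σ < σ₀ → ∀ Φ : (N : ℕ) → Flow σ N,
    ∀ τ : ℝ, 0 < τ → ∀ χ : ℝ × T3 → ℝ, Continuous χ → ∀ Ψ : V3 × V3 × V3 → ℝ, Continuous Ψ →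
    (∃ C : ℝ, ∀ p, |Ψ p| ≤ C) → ∀ η δ r : ℝ, 0 < η → 0 < δ → 0 < r →
    ∃ m₀ : ℕ, ∃ g : Fin m₀ → (V3 × V3 × V3 → ℝ), (∀ m, Continuous (g m)) ∧ (∀ m, ∃ C : ℝ, ∀ p, |g m p| ≤ C) ∧
      (∀ m, IsFluxMeanZero (g m)) ∧ ∃ C : ℝ, 0 ≤ C ∧ ∃ N₀ : ℕ, ∀ N : ℕ, N₀ ≤ N →
      ∃ s : Fin m₀ → (V3 × V3 → ℝ), (∀ m, Measurable (s m)) ∧ (∀ m p, |s m p| ≤ 1) ∧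
        localGibbsLaw σ a₀ u₀ θ₀ N (Φ N) {z | η < |trueDefect σ N (Φ N) τ χ Ψ r z|} ≤
          ((localGibbsLaw σ a₀ u₀ θ₀ N (Φ N)).prod kmDice) {q | η / 2 < |starDefect σ N τ χ Ψ r q|} +
            ENNReal.ofReal δ +
            ENNReal.ofReal C * ∑ m : Fin m₀, ∫⁻ z, ENNReal.ofReal
              |kickFunctional σ N (Φ N) τ r (g m) (velWeight N (s m)) z| ∂(localGibbsLaw σ a₀ u₀ θ₀ N (Φ N))

/-! ## Reshaped stubs (line lead, 2026-08-16): W = W1 ∧ W2 and S3 = S3a ∧ S3b, with proved glue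

The lead's reshape keeps the planner's four statements W, S1, S2, S3 and the composition through them verbatim, and
refines the two composite ones at the skeleton level (D-0019: total 6 ≤ `stubs_max` = 7 registered stubs, two layers):
* W  = `KickMatchedStationary` ⇐ W1 `KickMatchedMeasurable` (clause (i), pure measurability of the `Driven` recursion
  with the measurable rule `kmRule` — provable now on the template of `Alexander.torusFlow_measurable_holds`) ∧ W2
  `KickMatchedStationaryCore` (clauses (ii)–(iii): Gibbs-stationarity and a.s. well-posedness — the analytic part, on the
  template of `torusFlow_measurePreserving_holds` / `torusFlow_ae_good_holds`); glue `kickMatchedStationary_of`.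
* S3 = `KickAmbientDomination` ⇐ S3a `SwapIdentity` (the EXACT chronological swap identity
  `E φ_η(D_true) = E φ_η(D_{Z*}) + E swapSum_η` with the measurability / integrability it needs — strong Markov property of
  `Z*` at contacts (`Driven.stateAfter_succ'`), the law of `kmNormal` = normalised restricted flux law (Lambert lift +
  rejection sampling), Fubini over `kmDice ≅ Die ⊗ kmDice`; NO limit, NO dynamics estimate: size L, provable after W) ∧ S3b
  `SwapSumDomination` (the conspiracy proper: `|E swapSum_η| ≤ δ + C Σ_m ‖kickFunctional (g m) (velWeight (s m))‖_{L¹}` —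
  the line's open content, held by the lead); glue `kickAmbientDomination_of` (smoothing sandwich
  `1{η < |x|} ≤ φ_{η/2}(x) ≤ 1{η/2 < |x|}` + two Markov steps, PROVED below).
Why S3a is exactly true on good orbits: the hybrids "first m contacts resolved truly, `Z*` afterwards" interpolate between
`Z*` (m = 0) and the true orbit (m = numColl: after the last true collision in `(0, τ]` the `Z*` continuation shares the
free flight, so its next contact is the orbit's, `> τ`, and `defect` only reads the path on `[0, τ]`); consecutive hybrids
differ by `swapValue_m(ω_m) − E_die swapValue_m(kmNormal)` = `swapIntegrand_m(ω_m)` because the true kick is admissible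
(`kickAt` with `ω = trueKick` re-places the partner where it is: `translate x_i (−ε·ε⁻¹ sepVec x_i x_j) = x_j`) and, off
triple contacts (Liouville-null), the admissible set has positive flux measure so the sampler's law is the restricted
flux law; the sum telescopes PATHWISE, so `|swapSum| ≤ 1` wherever the identity holds (integrability is not an extra
assumption on `numColl`). -/

/-- **W2 · `KickMatchedStationaryCore`** — clauses (ii)–(iii) of `KickMatchedStationary` (verbatim): for `σ < σ₀`,
every `θe > 0`, `N`, `Φ`, the homogeneous Gibbs law `G_N = localGibbsLaw σ 1 0 θe N Φ` is invariant under `Z*_t`,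
`t ≥ 0` (heat-bath resampling of the normal on the exit-flux measure, then specular exit → entry), and `G_N ⊗ kmDice`-a.s.
the instants do not accumulate, the incoming pair of every collision is unique and the rejection sampler finds an
admissible candidate. [folklore] -/
def KickMatchedStationaryCore : Prop :=
  ∃ σ₀ : ℝ, 0 < σ₀ ∧ ∀ σ : ℝ, 0 < σ → σ < σ₀ → ∀ θe : ℝ, 0 < θe → ∀ (N : ℕ) (Φ : Flow σ N),
    (∀ t : ℝ, 0 ≤ t →
      ((localGibbsLaw σ (fun _ => 1) (fun _ => 0) (fun _ => θe) N Φ).prod kmDice).map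
          (fun q : Cfg N × (ℕ → Die) => kmFlow σ N q.2 q.1 t) =
        localGibbsLaw σ (fun _ => 1) (fun _ => 0) (fun _ => θe) N Φ) ∧
    (∀ᵐ q ∂((localGibbsLaw σ (fun _ => 1) (fun _ => 0) (fun _ => θe) N Φ).prod kmDice),
      (∀ t : ℝ, ∃ k : ℕ, ENNReal.ofReal t < Driven.instant geo (hsDiameter σ N) (kmRule σ N) q.2 q.1 k) ∧
      (∀ k : ℕ, Driven.instant geo (hsDiameter σ N) (kmRule σ N) q.2 q.1 (k + 1) ≠ ∞ →
        let y := Driven.stateAfter geo (hsDiameter σ N) (kmRule σ N) q.2 q.1 k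
        let y' := freeFlight geo (Alexander.freeExitTime geo (hsDiameter σ N) y).toReal y
        ∃ p ∈ Alexander.incomingPairs geo (hsDiameter σ N) y',
          (∀ p' ∈ Alexander.incomingPairs geo (hsDiameter σ N) y', p' = p) ∧
          ∃ n : ℕ, ‖q.2 k n‖ ≤ 1 ∧
            IsAdmissible σ N p.1 p.2
              (Lambert.lift (‖(y' p.2).2 - (y' p.1).2‖⁻¹ • ((y' p.2).2 - (y' p.1).2)) (q.2 k n)) y'))

/-- Glue W1 ∧ W2 ⇒ W. [folklore] -/
theorem kickMatchedStationary_of (h1 : KickMatchedMeasurable) (h2 : KickMatchedStationaryCore) :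
    KickMatchedStationary := by
  obtain ⟨σ₀, hσ₀, H⟩ := h2
  refine ⟨min (1 / 2) σ₀, lt_min one_half_pos hσ₀, fun σ hσ hσlt θe hθe N Φ => ⟨fun t => ?_, ?_⟩⟩
  · exact h1 σ hσ (lt_of_lt_of_le hσlt (min_le_left _ _)) N t
  · exact H σ hσ (lt_of_lt_of_le hσlt (min_le_right _ _)) θe hθe N Φ

/-- **S3a · `SwapIdentity` — the exact chronological Stein–Lindeberg swap identity for the gas, with its measure
theory.** For `σ < σ₀(profiles)`, every `Φ, τ, χ, Ψ, η, r, N`: the true and the `Z*` defects are a.e.-strongly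
measurable under their laws, the swap sum `swapSum … η` is integrable under the local Gibbs law, and
`∫ φ_η(D_true) dlG = ∫ φ_η(D_{Z*}) d(lG ⊗ kmDice) + ∫ swapSum_η dlG` (`stein_lindeberg_identity` on the contact-indexed
hybrids; see the section docstring for why it is exactly true on good orbits; `|swapSum| ≤ 1` a.e. comes with it).
No limit, no estimate on the dynamics: size L, provable after W. [folklore] -/
def SwapIdentity : Prop :=
  ∀ (a₀ θ₀ : T3 → ℝ) (u₀ : T3 → V3), Continuous a₀ → Continuous θ₀ → Continuous u₀ → (∀ x, 0 < a₀ x) →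
    (∀ x, 0 < θ₀ x) → ∃ σ₀ : ℝ, 0 < σ₀ ∧ ∀ σ : ℝ, 0 < σ → σ < σ₀ → ∀ Φ : (N : ℕ) → Flow σ N,
    ∀ τ : ℝ, 0 < τ → ∀ χ : ℝ × T3 → ℝ, Continuous χ → ∀ Ψ : V3 × V3 × V3 → ℝ, Continuous Ψ →
    (∃ C : ℝ, ∀ p, |Ψ p| ≤ C) → ∀ η r : ℝ, 0 < η → 0 < r → ∀ N : ℕ,
      AEStronglyMeasurable (trueDefect σ N (Φ N) τ χ Ψ r) (localGibbsLaw σ a₀ u₀ θ₀ N (Φ N)) ∧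
      AEStronglyMeasurable (starDefect σ N τ χ Ψ r) ((localGibbsLaw σ a₀ u₀ θ₀ N (Φ N)).prod kmDice) ∧
      Integrable (swapSum σ N (Φ N) τ χ Ψ r η) (localGibbsLaw σ a₀ u₀ θ₀ N (Φ N)) ∧
      ∫ z, phiEta η (trueDefect σ N (Φ N) τ χ Ψ r z) ∂(localGibbsLaw σ a₀ u₀ θ₀ N (Φ N)) =
        ∫ q, phiEta η (starDefect σ N τ χ Ψ r q) ∂((localGibbsLaw σ a₀ u₀ θ₀ N (Φ N)).prod kmDice) +
          ∫ z, swapSum σ N (Φ N) τ χ Ψ r η z ∂(localGibbsLaw σ a₀ u₀ θ₀ N (Φ N))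

/-- **S3b · `SwapSumDomination` — the kick–ambient conspiracy (the line's open content, HARDEST; held by the lead).**
For `σ < σ₀(profiles)`, every `Φ, τ, χ, Ψ` and `η, δ, r > 0` there are a finite dictionary `g_m` (`m < m₀`) of
continuous bounded flux-mean-zero kick tests and `C ≥ 0`, `N₀` such that for `N ≥ N₀` some measurable velocity weights
`|s_m| ≤ 1` give `|∫ swapSum_η dlG| ≤ δ + C Σ_m ‖kickFunctional (g m) (velWeight (s m))‖_{L¹(lG)}` (in `ℝ≥0∞`). Content
= steps (b)–(d) of the planner's S3 docstring: dictionary expansion of `D_k`, the `(v, w)`-conditional split paying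
typed `KickIsotropyInfo` with `s_m = sign ḡ_{k,m}`, and THE CONSPIRACY `→ 0` (identically `0` under the invariant Gibbs
law by Palm with the restricted reference; out of equilibrium carried by instantaneous 3-clusters at scale `Aε`).
[folklore] -/
def SwapSumDomination : Prop :=
  ∀ (a₀ θ₀ : T3 → ℝ) (u₀ : T3 → V3), Continuous a₀ → Continuous θ₀ → Continuous u₀ → (∀ x, 0 < a₀ x) →
    (∀ x, 0 < θ₀ x) → ∃ σ₀ : ℝ, 0 < σ₀ ∧ ∀ σ : ℝ, 0 < σ → σ < σ₀ → ∀ Φ : (N : ℕ) → Flow σ N,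
    ∀ τ : ℝ, 0 < τ → ∀ χ : ℝ × T3 → ℝ, Continuous χ → ∀ Ψ : V3 × V3 × V3 → ℝ, Continuous Ψ →
    (∃ C : ℝ, ∀ p, |Ψ p| ≤ C) → ∀ η δ r : ℝ, 0 < η → 0 < δ → 0 < r →
    ∃ m₀ : ℕ, ∃ g : Fin m₀ → (V3 × V3 × V3 → ℝ), (∀ m, Continuous (g m)) ∧ (∀ m, ∃ C : ℝ, ∀ p, |g m p| ≤ C) ∧
      (∀ m, IsFluxMeanZero (g m)) ∧ ∃ C : ℝ, 0 ≤ C ∧ ∃ N₀ : ℕ, ∀ N : ℕ, N₀ ≤ N →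
      ∃ s : Fin m₀ → (V3 × V3 → ℝ), (∀ m, Measurable (s m)) ∧ (∀ m p, |s m p| ≤ 1) ∧
        ENNReal.ofReal |∫ z, swapSum σ N (Φ N) τ χ Ψ r η z ∂(localGibbsLaw σ a₀ u₀ θ₀ N (Φ N))| ≤
          ENNReal.ofReal δ +
            ENNReal.ofReal C * ∑ m : Fin m₀, ∫⁻ z, ENNReal.ofReal
              |kickFunctional σ N (Φ N) τ r (g m) (velWeight N (s m)) z| ∂(localGibbsLaw σ a₀ u₀ θ₀ N (Φ N))

/-! ### The smoothing sandwich and the glue S3a ∧ S3b ⇒ S3 (proved) -/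

/-- `φ_η(x) = 0` for `|x| ≤ η`. [folklore] -/
theorem phiEta_eq_zero {η x : ℝ} (h : |x| ≤ η) : phiEta η x = 0 := by
  have : max (|x| - η) 0 = 0 := max_eq_right (by linarith)
  simp [phiEta, this]

/-- `φ_η(x) = 1` for `2η ≤ |x|`, `η > 0`. [folklore] -/
theorem phiEta_eq_one {η x : ℝ} (hη : 0 < η) (h : 2 * η ≤ |x|) : phiEta η x = 1 := by
  unfold phiEta
  refine min_eq_left ?_
  rw [le_div_iff₀ hη, one_mul]
  exact le_trans (by linarith) (le_max_left _ _)

/-- `φ_η` is continuous. [folklore] -/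
theorem continuous_phiEta (η : ℝ) : Continuous (phiEta η) := by
  unfold phiEta
  fun_prop

/-- Lower Markov step: `μ{η < |F|} ≤ ofReal (∫ φ_{η/2} ∘ F dμ)` for an a.e.-strongly measurable `F` on a finite measure
space. [folklore] -/
theorem measure_lt_abs_le_ofReal_integral_phiEta {α : Type*} [MeasurableSpace α] {μ : Measure α}
    [IsFiniteMeasure μ] {F : α → ℝ} (hF : AEStronglyMeasurable F μ) {η : ℝ} (hη : 0 < η) :
    μ {a | η < |F a|} ≤ ENNReal.ofReal (∫ a, phiEta (η / 2) (F a) ∂μ) := by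
  have hint : Integrable (fun a => phiEta (η / 2) (F a)) μ := by
    refine Integrable.of_bound ((continuous_phiEta _).comp_aestronglyMeasurable hF) 1 ?_
    exact Filter.Eventually.of_forall fun a => by
      rw [Real.norm_eq_abs, abs_of_nonneg (phiEta_nonneg (by positivity) _)]
      exact phiEta_le_one _ _
  rw [ofReal_integral_eq_lintegral_ofReal hint
    (Filter.Eventually.of_forall fun a => phiEta_nonneg (by positivity) _)]
  have hS : NullMeasurableSet {a | η < |F a|} μ :=
    (continuous_abs.measurable.comp_aemeasurable hF.aemeasurable).nullMeasurableSet_preimage measurableSet_Ioi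
  calc μ {a | η < |F a|} = ∫⁻ a, {a | η < |F a|}.indicator 1 a ∂μ := (lintegral_indicator_one₀ hS).symm
    _ ≤ ∫⁻ a, ENNReal.ofReal (phiEta (η / 2) (F a)) ∂μ := by
        refine lintegral_mono fun a => ?_
        by_cases ha : a ∈ {a | η < |F a|}
        · rw [Set.indicator_of_mem ha, Pi.one_apply, phiEta_eq_one (by positivity) (by
            have : η < |F a| := ha; linarith), ENNReal.ofReal_one]
        · rw [Set.indicator_of_notMem ha]
          exact bot_le

/-- Upper Markov step: `ofReal (∫ φ_η ∘ F dμ) ≤ μ{η < |F|}`. [folklore] -/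
theorem ofReal_integral_phiEta_le_measure {α : Type*} [MeasurableSpace α] {μ : Measure α}
    [IsFiniteMeasure μ] {F : α → ℝ} (hF : AEStronglyMeasurable F μ) {η : ℝ} (hη : 0 < η) :
    ENNReal.ofReal (∫ a, phiEta η (F a) ∂μ) ≤ μ {a | η < |F a|} := by
  have hint : Integrable (fun a => phiEta η (F a)) μ := by
    refine Integrable.of_bound ((continuous_phiEta _).comp_aestronglyMeasurable hF) 1 ?_
    exact Filter.Eventually.of_forall fun a => by
      rw [Real.norm_eq_abs, abs_of_nonneg (phiEta_nonneg hη.le _)]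
      exact phiEta_le_one _ _
  rw [ofReal_integral_eq_lintegral_ofReal hint (Filter.Eventually.of_forall fun a => phiEta_nonneg hη.le _)]
  have hS : NullMeasurableSet {a | η < |F a|} μ :=
    (continuous_abs.measurable.comp_aemeasurable hF.aemeasurable).nullMeasurableSet_preimage measurableSet_Ioi
  calc ∫⁻ a, ENNReal.ofReal (phiEta η (F a)) ∂μ ≤ ∫⁻ a, {a | η < |F a|}.indicator 1 a ∂μ := by
        refine lintegral_mono fun a => ?_
        by_cases ha : a ∈ {a | η < |F a|}
        · rw [Set.indicator_of_mem ha, Pi.one_apply]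
          exact ENNReal.ofReal_le_one.2 (phiEta_le_one _ _)
        · rw [Set.indicator_of_notMem ha, phiEta_eq_zero (by have : ¬ η < |F a| := ha; linarith),
            ENNReal.ofReal_zero]
    _ = μ {a | η < |F a|} := lintegral_indicator_one₀ hS

/-- **Glue S3a ∧ S3b ⇒ S3.** `lG{η < |D|} ≤ ofReal ∫φ_{η/2}(D) = ofReal (∫φ_{η/2}(D*) + ∫swapSum) ≤ P*{η/2 < |D*|} +
ofReal |∫ swapSum| ≤ P*{…} + δ + C Σ Kick`; thresholds `σ₀ := min (1/2) (min σa σb)` (`1/2` makes the local Gibbs law a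
probability measure, `isProbabilityMeasure_localGibbsLaw`). [folklore] -/
theorem kickAmbientDomination_of (hI : SwapIdentity) (hD : SwapSumDomination) : KickAmbientDomination := by
  intro a₀ θ₀ u₀ ha hθ hu ha0 hθ0
  obtain ⟨σI, hσI, HI⟩ := hI a₀ θ₀ u₀ ha hθ hu ha0 hθ0
  obtain ⟨σD, hσD, HD⟩ := hD a₀ θ₀ u₀ ha hθ hu ha0 hθ0
  refine ⟨min (1 / 2) (min σI σD), lt_min one_half_pos (lt_min hσI hσD),
    fun σ hσ hσlt Φ τ hτ χ hχ Ψ hΨ hΨb η δ r hη hδ hr => ?_⟩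
  have hσ2 : σ ≤ 1 / 2 := (lt_of_lt_of_le hσlt (min_le_left _ _)).le
  have hltI : σ < σI := lt_of_lt_of_le hσlt ((min_le_right _ _).trans (min_le_left _ _))
  have hltD : σ < σD := lt_of_lt_of_le hσlt ((min_le_right _ _).trans (min_le_right _ _))
  obtain ⟨m₀, g, hgc, hgb, hgf, C, hC, N₀, HDN⟩ :=
    HD σ hσ hltD Φ τ hτ χ hχ Ψ hΨ hΨb (η / 2) δ r (by positivity) hδ hr
  refine ⟨m₀, g, hgc, hgb, hgf, C, hC, N₀, fun N hN => ?_⟩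
  obtain ⟨s, hsm, hsb, Hdom⟩ := HDN N hN
  refine ⟨s, hsm, hsb, ?_⟩
  obtain ⟨hmT, hmS, _hint, hid⟩ := HI σ hσ hltI Φ τ hτ χ hχ Ψ hΨ hΨb (η / 2) r (by positivity) hr N
  haveI : IsProbabilityMeasure (localGibbsLaw σ a₀ u₀ θ₀ N (Φ N)) :=
    isProbabilityMeasure_localGibbsLaw ha hθ hu ha0 hθ0 hσ2 N (Φ N)
  calc localGibbsLaw σ a₀ u₀ θ₀ N (Φ N) {z | η < |trueDefect σ N (Φ N) τ χ Ψ r z|}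
      ≤ ENNReal.ofReal (∫ z, phiEta (η / 2) (trueDefect σ N (Φ N) τ χ Ψ r z) ∂(localGibbsLaw σ a₀ u₀ θ₀ N (Φ N))) :=
        measure_lt_abs_le_ofReal_integral_phiEta hmT hη
    _ = ENNReal.ofReal (∫ q, phiEta (η / 2) (starDefect σ N τ χ Ψ r q) ∂((localGibbsLaw σ a₀ u₀ θ₀ N (Φ N)).prod kmDice) +
          ∫ z, swapSum σ N (Φ N) τ χ Ψ r (η / 2) z ∂(localGibbsLaw σ a₀ u₀ θ₀ N (Φ N))) := by rw [hid]
    _ ≤ ENNReal.ofReal (∫ q, phiEta (η / 2) (starDefect σ N τ χ Ψ r q) ∂((localGibbsLaw σ a₀ u₀ θ₀ N (Φ N)).prod kmDice)) +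
          ENNReal.ofReal |∫ z, swapSum σ N (Φ N) τ χ Ψ r (η / 2) z ∂(localGibbsLaw σ a₀ u₀ θ₀ N (Φ N))| :=
        ENNReal.ofReal_add_le.trans (add_le_add le_rfl (ENNReal.ofReal_le_ofReal (le_abs_self _)))
    _ ≤ ((localGibbsLaw σ a₀ u₀ θ₀ N (Φ N)).prod kmDice) {q | η / 2 < |starDefect σ N τ χ Ψ r q|} +
          (ENNReal.ofReal δ + ENNReal.ofReal C * ∑ m : Fin m₀, ∫⁻ z, ENNReal.ofReal
              |kickFunctional σ N (Φ N) τ r (g m) (velWeight N (s m)) z| ∂(localGibbsLaw σ a₀ u₀ θ₀ N (Φ N))) :=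
        add_le_add (ofReal_integral_phiEta_le_measure hmS (by positivity)) Hdom
    _ = _ := (add_assoc _ _ _).symm

end Literature.MathematicalPhysics.KineticTheory
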